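import Summits.NavierStokesRegularity.FunctionalMining.NoGo.TopBotEigSplitting
import Summits.NavierStokesRegularity.FunctionalMining.NoGo.TopBotEigSplitFloorLeTwo
import HarnessLib

/-!
# FunctionalMining / NoGo — K13b: the splitting of the symmetrised top–bottom core for every real
# `1 < q ≤ 2`, hence for EVERY REAL `q > 1` — `∃ c > 0, TopBotEigSplitting q c` PROVED (door
# D-K6 (c), finite-dimensional side, part 2 of 2)

HONEST FRAMING. Search for candidate a priori estimates; no regularity claim. Nothing about
Navier–Stokes is proved or asserted in this file: finite-dimensional convex analysis for flat
`3 × 3` tensors. Cell `pub-nsfunc`, no-go seat (gen 40), kernel candidate K13 = K13a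
`NoGo/TopBotEigSplitFloorLeTwo` (floor `1 ≤ q ≤ 2`, ceiling `0 < q ≤ 2`) and K13b (this file;
imports the tree's K10c `NoGo/TopBotEigSplitting` — `tfProj`, `splitGauge` — and K13a).

THE TARGET. `TopEig.TopBotEigSplitting q c` (K9 `NoGo/TopBotEigHeatCoerciveSplit`): `M ≥ 0` and
a convex `1`-Lipschitz `h ≥ 0` on flat tensors with `λ(A)^q + λ(−A)^q = M·h(A)^q + c·‖A‖^q` for
every symmetric trace-free `A`. K10c proved `∃ c > 0, TopBotEigSplitting q c` for real `q ≥ 2`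
with the hypotheses `2 ≤ q`, `c ≤ shareConst q` hard-wired into every lemma of its §8–§9. This
file re-runs that local-to-global assembly ONCE over a typed hypothesis (`TopEig.LocalSplit q c κ`:
the split density `k_{q,c} = f_q − c‖·‖^q` is `≥ 0` on symmetric trace-free tensors and has
non-negative second differences for steps `κ‖X‖ ≤ ‖B‖`, `B ≠ 0`), and instantiates it twice:
below two from K13a (ratio `κ = 6`, share `c₂(q) = min(2(q−1)/21, 2·36^{−q/2})`), above two from
the tree's K10b (ratio `2`, share `shareConst q`).

WHAT IS PROVED HERE [ours]:
* §4 `TopEig.LocalSplit q c κ` (a `Prop`-valued structure = the typed hypothesis; nothing is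
  assumed about it, two instances are PROVED in §5) and, for `h : LocalSplit q c κ`:
  `h.convexOn_splitDensity_tfProj : ConvexOn ℝ univ (k_{q,c} ∘ π)` (local midpoint convexity
  along lines, `convexOn_univ_of_local_midpoint` of K10b, radius `‖P‖/(κ‖πY‖+1)`; where the line
  meets `0` one uses `k ≥ 0 = k(0)`); the gauge `splitGauge q c = (k∘π/2)^{1/q}` is `≥ 0`,
  positively homogeneous, `≤ ‖·‖`, **convex** (`h.convexOn_splitGauge`), subadditive,
  **`1`-Lipschitz** (`h.lipschitzWith_splitGauge`), with the SPLITTING IDENTITY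
  `λ(A)^q + λ(−A)^q = 2·h(A)^q + c‖A‖^q` on symmetric trace-free `A`; hence
  **`TopEig.LocalSplit.splitting : LocalSplit q c κ → (TopBotEigSplitting q c, written out)`**.
* §5 `shareConstLeTwo q = min (2(q−1)/21) (2·(1/36)^{q/2})` (`> 0` for `q > 1`);
  `splitDensity_nonneg_of_le` (`q > 0`, `c ≤ 2·36^{−q/2}`); `splitDensity_secondDiff_nonneg_of_le_two`
  (`1 ≤ q ≤ 2`, `0 ≤ c ≤ 2(q−1)/21`, `6‖X‖ ≤ ‖B‖`: K13a's floor `2q(q−1)/21` against `c ×` K13a's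
  ceiling `q`); the instances **`localSplit_of_le_two (hq1 : 1 < q) (hq2 : q ≤ 2) (hc0 : 0 ≤ c)
  (hc : c ≤ shareConstLeTwo q) : LocalSplit q c 6`** and `localSplit_of_two_le (hq : 2 ≤ q) … :
  LocalSplit q c 2` (the tree's K10b `splitDensity_nonneg` / `splitDensity_secondDiff_nonneg`).
* §6 **`TopEig.topBotEigSplitting_shareConstLeTwo (hq1 : 1 < q) (hq2 : q ≤ 2)`** =
  `TopBotEigSplitting q (shareConstLeTwo q)` written out word for word, and
  **`TopEig.topBotEigSplitting_exists_of_one_lt (hq : 1 < q) : ∃ c, 0 < c ∧ (TopBotEigSplitting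
  q c, written out)`** for EVERY REAL `q > 1`. Composed with K12
  (`topBotEigHeatCoercivePos_of_splitting_of_lt_two`, `1 < q < 2`), K7 (`q = 2`) and K9
  (`topBotEigHeatCoercivePos_of_splitting`, `q > 2`) this gives `TopBotEigHeatCoercivePos q` for
  every real `q > 1` — the no-go seat's JOINT E-check, not a tree file until K12 is filed.
No eigenvalue calculus beyond `λ` is used anywhere (no Lewis–Sendov / Davis, no smoothness of
eigenvalues, no eigenvectors); rates and shares are not sharp.

WHAT IS NOT PROVED HERE. Door (b) (`3/2 < q < 2`: the sign of the stretching of the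
`|λ₂|`-moment against the heat gain) is untouched and OPEN both ways; nothing at `q ≤ 1`; no sharp
share (`c₂(3/2) = 1/21`).

PROVENANCE / STATUS. Typed and farm-checked by the no-go seat (gen 40) as the concatenation
K13a+K13b under the tree import K10c (evidence `pub-nsfunc-nogo/sieveld/kti/`: `check_AB.json`
rc 0 · 0/0/0 · `--axioms topBotEigSplitting_exists_of_one_lt` std; E-check `K13.ECHECK.lean` with
the staged K11/K12 bodies: `topBotEigHeatCoercivePos_of_one_lt (hq : 1 < q) :
TopBotEigHeatCoercivePos (d := Fin 3) q` rc 0 · std); STATUS: STAGED, filing by a prove seat on the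
lead's word AFTER K13a (the planner seat cannot file under `FunctionalMining/`). Search for
candidate a priori estimates; no regularity claim. [ours; K1-Q6 (c) = door D-K6 (c),
finite-dimensional side, every real `q > 1`]
FILING (prove seat g26, REQUEST #27b): declarations byte-identical to the no-go seat's staged `TopBotEigSplittingLocal.STAGING.lean` b2bbb36e09ba619c; this line is the only addition.
-/

noncomputable section

open Finset Set Real

namespace Summit.NavierStokesRegularity.FunctionalMining

namespace TopEig

/-! ## 4. Local splitting data and the generic local-to-global assembly -/

/-- **Local splitting data** for the exponent `q`, the share `c` and the step ratio `κ` (a typed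
HYPOTHESIS, instantiated in §5): `q > 0`, `c ≥ 0`, `κ > 0`, the split density
`k_{q,c} = f_q − c‖·‖^q` is `≥ 0` on symmetric trace-free tensors, and
`2k(B) ≤ k(B+X) + k(B−X)` for symmetric trace-free `B ≠ 0`, `X` with `κ‖X‖ ≤ ‖B‖`. [ours] -/
structure LocalSplit (q c κ : ℝ) : Prop where
  /-- `q > 0`. -/
  q_pos : 0 < q
  /-- `c ≥ 0`. -/
  share_nonneg : 0 ≤ c
  /-- `κ > 0`. -/
  ratio_pos : 0 < κ
  /-- `k_{q,c} ≥ 0` on symmetric trace-free tensors. -/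
  nonneg : ∀ A : Tens3, IsSymTF A → 0 ≤ splitDensity q c A
  /-- Non-negative second differences of `k_{q,c}` for steps `κ‖X‖ ≤ ‖B‖`, `B ≠ 0`. -/
  secondDiff : ∀ B X : Tens3, IsSymTF B → IsSymTF X → B ≠ 0 → κ * ‖X‖ ≤ ‖B‖ →
    2 * splitDensity q c B ≤ splitDensity q c (B + X) + splitDensity q c (B - X)

namespace LocalSplit

variable {q c κ : ℝ}

/-- **`k_{q,c} ∘ π` is convex on `Tens3`** under local splitting data (local midpoint convexity
along lines, `TopBotEigSplitCeiling` §6, with the step ratio `κ`; the points where the line passes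
through `0` are handled by `k ≥ 0`, `k(0) = 0`). [ours] -/
theorem convexOn_splitDensity_tfProj (h : LocalSplit q c κ) :
    ConvexOn ℝ univ (fun A : Tens3 => splitDensity q c (tfProj A)) := by
  refine convexOn_univ_of_lines fun A Y => ?_
  have hB : IsSymTF (tfProj A) := isSymTF_tfProj A
  have hZ : IsSymTF (tfProj Y) := isSymTF_tfProj Y
  have hφ : (fun t : ℝ => splitDensity q c (tfProj (A + t • Y))) =
      fun t : ℝ => splitDensity q c (tfProj A + t • tfProj Y) := by
    funext t; rw [tfProj_add, tfProj_smul]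
  show ConvexOn ℝ univ (fun t : ℝ => splitDensity q c (tfProj (A + t • Y)))
  rw [hφ]
  refine convexOn_univ_of_local_midpoint
    ((continuous_splitDensity h.q_pos c).comp (by fun_prop)) fun m => ?_
  by_cases hP : tfProj A + m • tfProj Y = 0
  · refine ⟨1, one_pos, fun δ _ _ => ?_⟩
    have e0 : splitDensity q c (tfProj A + m • tfProj Y) = 0 := by
      rw [hP, splitDensity_zero h.q_pos]
    have h1 := h.nonneg _ (hB.add (hZ.smul (m - δ)))
    have h2 := h.nonneg _ (hB.add (hZ.smul (m + δ)))
    show 2 * splitDensity q c (tfProj A + m • tfProj Y) ≤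
      splitDensity q c (tfProj A + (m - δ) • tfProj Y) +
        splitDensity q c (tfProj A + (m + δ) • tfProj Y)
    linarith
  · have hPn : 0 < ‖tfProj A + m • tfProj Y‖ := norm_pos_iff.mpr hP
    have hκ := h.ratio_pos
    refine ⟨‖tfProj A + m • tfProj Y‖ / (κ * ‖tfProj Y‖ + 1), div_pos hPn (by positivity),
      fun δ hδ hδle => ?_⟩
    have hXB : κ * ‖δ • tfProj Y‖ ≤ ‖tfProj A + m • tfProj Y‖ := by
      rw [norm_smul, Real.norm_of_nonneg hδ.le]
      have hZ0 := norm_nonneg (tfProj Y)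
      have h3 : δ * (κ * ‖tfProj Y‖ + 1) ≤ ‖tfProj A + m • tfProj Y‖ := by
        rwa [le_div_iff₀ (by positivity)] at hδle
      nlinarith [mul_nonneg hκ.le hZ0]
    have key := h.secondDiff _ _ (hB.add (hZ.smul m)) (hZ.smul δ) hP hXB
    have e1 : tfProj A + m • tfProj Y + δ • tfProj Y = tfProj A + (m + δ) • tfProj Y := by
      rw [add_smul, add_assoc]
    have e2 : tfProj A + m • tfProj Y - δ • tfProj Y = tfProj A + (m - δ) • tfProj Y := by
      rw [sub_smul, add_sub_assoc]
    rw [e1, e2] at key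
    show 2 * splitDensity q c (tfProj A + m • tfProj Y) ≤
      splitDensity q c (tfProj A + (m - δ) • tfProj Y) +
        splitDensity q c (tfProj A + (m + δ) • tfProj Y)
    linarith

/-- `k(πA) ≥ 0`. -/
theorem splitDensity_tfProj_nonneg (h : LocalSplit q c κ) (A : Tens3) :
    0 ≤ splitDensity q c (tfProj A) :=
  h.nonneg _ (isSymTF_tfProj A)

/-- `h(A) ≥ 0` for the gauge `h = splitGauge q c` of `TopBotEigSplitting`. -/
theorem splitGauge_nonneg (h : LocalSplit q c κ) (A : Tens3) : 0 ≤ splitGauge q c A :=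
  Real.rpow_nonneg (div_nonneg (h.splitDensity_tfProj_nonneg A) two_pos.le) _

/-- `h(A)^q = k(πA)/2`. -/
theorem splitGauge_rpow (h : LocalSplit q c κ) (A : Tens3) :
    splitGauge q c A ^ q = splitDensity q c (tfProj A) / 2 := by
  unfold splitGauge
  exact Real.rpow_inv_rpow (div_nonneg (h.splitDensity_tfProj_nonneg A) two_pos.le) h.q_pos.ne'

/-- Positive homogeneity `h(tA) = t·h(A)`, `t ≥ 0`. -/
theorem splitGauge_smul (h : LocalSplit q c κ) {t : ℝ} (ht : 0 ≤ t) (A : Tens3) :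
    splitGauge q c (t • A) = t * splitGauge q c A := by
  unfold splitGauge
  rw [tfProj_smul, splitDensity_smul q c ht, mul_div_assoc,
    Real.mul_rpow (Real.rpow_nonneg ht q) (div_nonneg (h.splitDensity_tfProj_nonneg A) two_pos.le),
    Real.rpow_rpow_inv ht h.q_pos.ne']

/-- `h ≤ ‖·‖` (`k ≤ f_q ≤ 2‖·‖^q` and `‖πA‖ ≤ ‖A‖`). -/
theorem splitGauge_le_norm (h : LocalSplit q c κ) (A : Tens3) : splitGauge q c A ≤ ‖A‖ := by
  have hq0 := h.q_pos
  have h1 : splitDensity q c (tfProj A) / 2 ≤ ‖A‖ ^ q := by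
    have hf := coreDensity_le_two_mul_normDensity hq0 (tfProj A)
    have hN : 0 ≤ normDensity q (tfProj A) := normDensity_nonneg q _
    have hπ : normDensity q (tfProj A) ≤ ‖A‖ ^ q := by
      rw [normDensity_eq]
      exact Real.rpow_le_rpow (norm_nonneg _) (norm_tfProj_le A) hq0.le
    unfold splitDensity
    nlinarith [mul_nonneg h.share_nonneg hN]
  calc splitGauge q c A ≤ (‖A‖ ^ q) ^ q⁻¹ :=
        Real.rpow_le_rpow (div_nonneg (h.splitDensity_tfProj_nonneg A) two_pos.le) h1
          (inv_nonneg.2 hq0.le)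
    _ = ‖A‖ := Real.rpow_rpow_inv (norm_nonneg A) hq0.ne'

/-- **The gauge is convex** under local splitting data (convexity and `q`-homogeneity of
`k∘π`; the proof of `TopBotEigSplitting.convexOn_splitGauge` with the hypotheses replaced). [ours] -/
theorem convexOn_splitGauge (h : LocalSplit q c κ) : ConvexOn ℝ univ (splitGauge q c) := by
  have hq0 := h.q_pos
  have hK := h.convexOn_splitDensity_tfProj
  refine ⟨convex_univ, fun A _ B _ a b ha hb hab => ?_⟩
  simp only [smul_eq_mul]
  refine le_of_forall_pos_le_add fun ε hε => ?_
  set u : ℝ := splitGauge q c A + ε with hudef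
  set v : ℝ := splitGauge q c B + ε with hvdef
  have hu : 0 < u := by have := h.splitGauge_nonneg A; linarith
  have hv : 0 < v := by have := h.splitGauge_nonneg B; linarith
  have hKle : ∀ {w : ℝ} (C : Tens3), 0 < w → splitGauge q c C ≤ w →
      splitDensity q c (tfProj (w⁻¹ • C)) ≤ 2 := by
    intro w C hw hCw
    have hg : splitGauge q c (w⁻¹ • C) ≤ 1 := by
      rw [h.splitGauge_smul (inv_nonneg.2 hw.le), inv_mul_le_iff₀ hw]; simpa using hCw
    have h4 := Real.rpow_le_one (h.splitGauge_nonneg _) hg hq0.le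
    rw [h.splitGauge_rpow] at h4
    linarith
  have hA2 := hKle A hu (by linarith)
  have hB2 := hKle B hv (by linarith)
  set w : ℝ := a * u + b * v with hwdef
  have hw0 : 0 ≤ w := by positivity
  rcases hw0.eq_or_lt with hw | hw
  · exfalso
    have h1 : a * u = 0 := by nlinarith [mul_nonneg ha hu.le, mul_nonneg hb hv.le]
    have h2 : b * v = 0 := by nlinarith [mul_nonneg ha hu.le, mul_nonneg hb hv.le]
    rcases mul_eq_zero.1 h1 with h5 | h5
    · rcases mul_eq_zero.1 h2 with h6 | h6
      · linarith
      · linarith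
    · linarith
  · have hsum : a * u / w + b * v / w = 1 := by
      rw [← add_div, div_self hw.ne']
    have hcomb := hK.2 (mem_univ (u⁻¹ • A)) (mem_univ (v⁻¹ • B))
      (div_nonneg (mul_nonneg ha hu.le) hw.le) (div_nonneg (mul_nonneg hb hv.le) hw.le) hsum
    simp only [smul_eq_mul] at hcomb
    have hin : splitDensity q c (tfProj ((a * u / w) • (u⁻¹ • A) + (b * v / w) • (v⁻¹ • B))) ≤ 2 := by
      have h5 : a * u / w * splitDensity q c (tfProj (u⁻¹ • A)) +
          b * v / w * splitDensity q c (tfProj (v⁻¹ • B)) ≤ a * u / w * 2 + b * v / w * 2 :=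
        add_le_add (mul_le_mul_of_nonneg_left hA2 (div_nonneg (mul_nonneg ha hu.le) hw.le))
          (mul_le_mul_of_nonneg_left hB2 (div_nonneg (mul_nonneg hb hv.le) hw.le))
      have e2 : a * u / w * 2 + b * v / w * 2 = 2 := by rw [← add_mul, hsum, one_mul]
      linarith
    have e : a • A + b • B = w • ((a * u / w) • (u⁻¹ • A) + (b * v / w) • (v⁻¹ • B)) := by
      rw [smul_add, smul_smul, smul_smul, smul_smul, smul_smul]
      congr 1 <;> congr 1
      · field_simp
      · field_simp
    have hg1 : splitGauge q c ((a * u / w) • (u⁻¹ • A) + (b * v / w) • (v⁻¹ • B)) ≤ 1 := by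
      unfold splitGauge
      exact Real.rpow_le_one (div_nonneg (h.splitDensity_tfProj_nonneg _) two_pos.le)
        (by linarith) (inv_nonneg.2 hq0.le)
    calc splitGauge q c (a • A + b • B)
        = w * splitGauge q c ((a * u / w) • (u⁻¹ • A) + (b * v / w) • (v⁻¹ • B)) := by
          rw [e, h.splitGauge_smul hw.le]
      _ ≤ w * 1 := mul_le_mul_of_nonneg_left hg1 hw.le
      _ = a * splitGauge q c A + b * splitGauge q c B + ε := by
          rw [mul_one, hwdef, hudef, hvdef]; linear_combination ε * hab

/-- Subadditivity of the gauge. -/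
theorem splitGauge_add_le (h : LocalSplit q c κ) (A B : Tens3) :
    splitGauge q c (A + B) ≤ splitGauge q c A + splitGauge q c B := by
  have h1 := h.convexOn_splitGauge.2 (mem_univ A) (mem_univ B)
    (by norm_num : (0 : ℝ) ≤ 1 / 2) (by norm_num : (0 : ℝ) ≤ 1 / 2) (by norm_num)
  have e : (1 / 2 : ℝ) • A + (1 / 2 : ℝ) • B = (1 / 2 : ℝ) • (A + B) := by rw [smul_add]
  rw [e, h.splitGauge_smul (by norm_num)] at h1
  simp only [smul_eq_mul] at h1
  linarith

/-- **The gauge is `1`-Lipschitz** under local splitting data. [ours] -/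
theorem lipschitzWith_splitGauge (h : LocalSplit q c κ) : LipschitzWith 1 (splitGauge q c) :=
  LipschitzWith.of_le_add fun A B => by
    have h1 := h.splitGauge_add_le B (A - B)
    rw [add_sub_cancel] at h1
    have h2 := h.splitGauge_le_norm (A - B)
    rw [dist_eq_norm]; linarith

/-- **The splitting identity** on symmetric trace-free tensors:
`λ(A)^q + λ(−A)^q = 2·h(A)^q + c·‖A‖^q`. [ours] -/
theorem splitting_identity (h : LocalSplit q c κ) {A : Tens3} (hA : IsSymTF A) :
    lam A ^ q + lam (-A) ^ q = 2 * splitGauge q c A ^ q + c * ‖A‖ ^ q := by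
  rw [h.splitGauge_rpow, tfProj_of_isSymTF hA, splitDensity, coreDensity_eq hA, normDensity_eq]
  ring

/-- **LOCAL-TO-GLOBAL ASSEMBLY**: local splitting data for `(q, c, κ)` give the statement
`TopBotEigSplitting q c` of the K9 file `TopBotEigHeatCoerciveSplit`, written out (witness
`M = 2`, `h = splitGauge q c`). [ours] -/
theorem splitting (h : LocalSplit q c κ) :
    ∃ M : ℝ, 0 ≤ M ∧ ∃ h : EuclideanSpace ℝ (Fin 3 × Fin 3) → ℝ,
      ConvexOn ℝ univ h ∧ LipschitzWith 1 h ∧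
        ∀ A : EuclideanSpace ℝ (Fin 3 × Fin 3), (∀ i j, A (i, j) = A (j, i)) →
          ∑ i, A (i, i) = 0 →
            0 ≤ h A ∧ lam A ^ q + lam (-A) ^ q = M * h A ^ q + c * ‖A‖ ^ q :=
  ⟨2, two_pos.le, splitGauge q c, h.convexOn_splitGauge, h.lipschitzWith_splitGauge,
    fun A hs ht => ⟨h.splitGauge_nonneg A, h.splitting_identity ⟨hs, ht⟩⟩⟩

end LocalSplit

/-! ## 5. The instances: `1 < q ≤ 2` (this file's floor and ceiling, ratio `6`) and `2 ≤ q`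
(`TopBotEigSplitCeiling`, ratio `2`) -/

/-- The SHARE below two: `c₂(q) = min( 2(q−1)/21 , 2·36^{−q/2} )`. [ours] -/
def shareConstLeTwo (q : ℝ) : ℝ := min (2 * (q - 1) / 21) (2 * (1 / 36 : ℝ) ^ (q / 2))

/-- `c₂(q) > 0` for `q > 1`. -/
theorem shareConstLeTwo_pos {q : ℝ} (hq : 1 < q) : 0 < shareConstLeTwo q :=
  lt_min (by have : 0 < q - 1 := by linarith
             positivity) (mul_pos two_pos (Real.rpow_pos_of_pos (by norm_num) _))

/-- `k_{q,c} ≥ 0` on symmetric trace-free tensors for `q > 0`, `c ≤ 2·36^{−q/2}`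
(`f_q ≥ 2(‖A‖²/36)^{q/2}`, `TopBotEigSplitFloor`). [ours] -/
theorem splitDensity_nonneg_of_le {q c : ℝ} (hq : 0 < q) (hc : c ≤ 2 * (1 / 36 : ℝ) ^ (q / 2))
    {A : Tens3} (hA : IsSymTF A) : 0 ≤ splitDensity q c A := by
  have hf := two_mul_rpow_le_coreDensity hq hA
  rw [show ‖A‖ ^ 2 / 36 = (1 / 36 : ℝ) * ‖A‖ ^ 2 by ring,
    Real.mul_rpow (by norm_num) (sq_nonneg _)] at hf
  have hN : 0 ≤ normDensity q A := normDensity_nonneg q A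
  unfold splitDensity
  unfold normDensity at hN ⊢
  nlinarith [mul_le_mul_of_nonneg_right hc hN]

/-- **Non-negative second differences of `k_{q,c}` below two**: for `1 ≤ q ≤ 2`,
`0 ≤ c ≤ 2(q−1)/21`, symmetric trace-free `B ≠ 0`, `X` with `6‖X‖ ≤ ‖B‖`:
`2k(B) ≤ k(B+X) + k(B−X)` (floor `2q(q−1)/21` of §2 against `c ×` the ceiling `q` of §3). [ours] -/
theorem splitDensity_secondDiff_nonneg_of_le_two {q c : ℝ} (hq1 : 1 ≤ q) (hq2 : q ≤ 2)
    (hc0 : 0 ≤ c) (hc : c ≤ 2 * (q - 1) / 21) {B X : Tens3} (hB : IsSymTF B) (hX : IsSymTF X)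
    (hB0 : B ≠ 0) (hXB : 6 * ‖X‖ ≤ ‖B‖) :
    2 * splitDensity q c B ≤ splitDensity q c (B + X) + splitDensity q c (B - X) := by
  have hq0 : 0 < q := by linarith
  have hF := coreDensity_secondDiff_ge_of_le_two hq1 hq2 hB hX hB0 hXB
  have hN := normDensity_secondDiff_le_of_le_two hq0 hq2 hB0 X
  have hP : 0 ≤ q * ((‖B‖ ^ 2) ^ (q / 2 - 1) * ‖X‖ ^ 2) :=
    mul_nonneg hq0.le (mul_nonneg (Real.rpow_nonneg (sq_nonneg _) _) (sq_nonneg _))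
  have h1 : c * (normDensity q (B + X) + normDensity q (B - X) - 2 * normDensity q B) ≤
      c * (q * (‖B‖ ^ 2) ^ (q / 2 - 1) * ‖X‖ ^ 2) := mul_le_mul_of_nonneg_left hN hc0
  have h2 : c * (q * ((‖B‖ ^ 2) ^ (q / 2 - 1) * ‖X‖ ^ 2)) ≤
      2 * (q - 1) / 21 * (q * ((‖B‖ ^ 2) ^ (q / 2 - 1) * ‖X‖ ^ 2)) :=
    mul_le_mul_of_nonneg_right hc hP
  have e1 : c * (q * (‖B‖ ^ 2) ^ (q / 2 - 1) * ‖X‖ ^ 2) =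
      c * (q * ((‖B‖ ^ 2) ^ (q / 2 - 1) * ‖X‖ ^ 2)) := by ring
  have e2 : 2 * (q - 1) / 21 * (q * ((‖B‖ ^ 2) ^ (q / 2 - 1) * ‖X‖ ^ 2)) =
      2 * q * (q - 1) / 21 * (‖B‖ ^ 2) ^ (q / 2 - 1) * ‖X‖ ^ 2 := by ring
  rw [e1] at h1
  rw [e2] at h2
  unfold splitDensity
  linarith [hF, h1, h2]

/-- **Local splitting data below two**: `1 < q ≤ 2`, `0 ≤ c ≤ c₂(q)`, ratio `6`. [ours] -/
theorem localSplit_of_le_two {q : ℝ} (hq1 : 1 < q) (hq2 : q ≤ 2) {c : ℝ} (hc0 : 0 ≤ c)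
    (hc : c ≤ shareConstLeTwo q) : LocalSplit q c 6 where
  q_pos := by linarith
  share_nonneg := hc0
  ratio_pos := by norm_num
  nonneg := fun _ hA => splitDensity_nonneg_of_le (by linarith) (hc.trans (min_le_right _ _)) hA
  secondDiff := fun _ _ hB hX hB0 hXB =>
    splitDensity_secondDiff_nonneg_of_le_two hq1.le hq2 hc0 (hc.trans (min_le_left _ _)) hB hX hB0 hXB

/-- **Local splitting data above two** (`TopBotEigSplitCeiling` §5): `2 ≤ q`, `0 ≤ c ≤ c(q)`,
ratio `2`. [ours] -/
theorem localSplit_of_two_le {q : ℝ} (hq : 2 ≤ q) {c : ℝ} (hc0 : 0 ≤ c) (hc : c ≤ shareConst q) :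
    LocalSplit q c 2 where
  q_pos := by linarith
  share_nonneg := hc0
  ratio_pos := two_pos
  nonneg := fun _ hA => splitDensity_nonneg hq hc hA
  secondDiff := fun _ _ hB hX hB0 hXB => splitDensity_secondDiff_nonneg hq hc0 hc hB hX hB0 hXB

/-! ## 6. Headlines: the splitting for `1 < q ≤ 2`, and for every real `q > 1` -/

/-- **K13 — the splitting of the symmetrised top–bottom core for `1 < q ≤ 2`, with the share
`c₂(q) = shareConstLeTwo q > 0`**: the statement `TopBotEigSplitting q (shareConstLeTwo q)` of
the K9 file, written out. [ours] -/
theorem topBotEigSplitting_shareConstLeTwo {q : ℝ} (hq1 : 1 < q) (hq2 : q ≤ 2) :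
    ∃ M : ℝ, 0 ≤ M ∧ ∃ h : EuclideanSpace ℝ (Fin 3 × Fin 3) → ℝ,
      ConvexOn ℝ univ h ∧ LipschitzWith 1 h ∧
        ∀ A : EuclideanSpace ℝ (Fin 3 × Fin 3), (∀ i j, A (i, j) = A (j, i)) →
          ∑ i, A (i, i) = 0 →
            0 ≤ h A ∧ lam A ^ q + lam (-A) ^ q = M * h A ^ q + shareConstLeTwo q * ‖A‖ ^ q :=
  (localSplit_of_le_two hq1 hq2 (shareConstLeTwo_pos hq1).le le_rfl).splitting

/-- **K13, every real `q > 1`**: `∃ c > 0, TopBotEigSplitting q c` written out (`q ≤ 2`: this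
file; `q ≥ 2`: `TopBotEigSplitCeiling`/`TopBotEigSplitting`, through the same assembly). Composed
with K9 (`q > 2`), K12 (`1 < q < 2`) and K7 (`q = 2`) it gives `TopBotEigHeatCoercivePos q` for
every real `q > 1` (JOINT check file). [ours] -/
theorem topBotEigSplitting_exists_of_one_lt {q : ℝ} (hq : 1 < q) :
    ∃ c : ℝ, 0 < c ∧ ∃ M : ℝ, 0 ≤ M ∧ ∃ h : EuclideanSpace ℝ (Fin 3 × Fin 3) → ℝ,
      ConvexOn ℝ univ h ∧ LipschitzWith 1 h ∧
        ∀ A : EuclideanSpace ℝ (Fin 3 × Fin 3), (∀ i j, A (i, j) = A (j, i)) →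
          ∑ i, A (i, i) = 0 →
            0 ≤ h A ∧ lam A ^ q + lam (-A) ^ q = M * h A ^ q + c * ‖A‖ ^ q := by
  rcases le_or_gt q 2 with hq2 | hq2
  · exact ⟨shareConstLeTwo q, shareConstLeTwo_pos hq,
      (localSplit_of_le_two hq hq2 (shareConstLeTwo_pos hq).le le_rfl).splitting⟩
  · exact ⟨shareConst q, shareConst_pos hq2.le,
      (localSplit_of_two_le hq2.le (shareConst_pos hq2.le).le le_rfl).splitting⟩

end TopEig

end Summit.NavierStokesRegularity.FunctionalMining
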